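import Literature.Probability.RandomPlanarGeometry.SAWKestenHairpin
import Literature.Probability.RandomPlanarGeometry.SAWHairpinDensity
import HarnessLib

/-!
# The unconditional explicit Kesten ratio rate on `ℤ²` (lane pcv-sawmu, KR-3 closed with HP)

`SAWKestenHairpin.lean` proves Kesten's inequality (7.3.3) and the ratio rate `|c_{N+2}/c_N − μ²| ≤
K √((G(2N)+1)/N)` in every dimension from the hairpin-sparsity input `KestenHairpin.HairpinSparse d Q C`;
`SAWHairpinDensity.lean` (lane item HP) proves that input on `ℤ²` with `Q = 320`, `C = Σ_{r<20} c_r`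
(`Zd.hairpin_density_explicit`, Madras–Slade Theorem 7.2.3 for the U-turn pattern with explicit constants).
This file puts the two together: Kesten's ratio limit theorem `c_{N+2}/c_N → μ²` on `ℤ²` (Kesten 1963;
Madras–Slade Theorem 7.3.2 (a), (7.5.1)) with an EXPLICIT inequality constant and an EXPLICIT rate, no hypothesis.
The axioms are the standard ones plus the lane's certified lower bound `μ ≥ 2.604` entering through HP.
-/

noncomputable section

open Filter Topology Literature.Probability.LatticeModels Literature.Probability.Percolation SimpleGraph
open scoped BigOperators

namespace Literature.Probability.RandomPlanarGeometry.SAW.Zd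

namespace KestenHairpin

/-- The two spellings of the U-turn event agree (this file's bookkeeping and `SAWHairpinDensity.lean`).
[folklore] -/
private theorem hairpinAt_eq_hairpinAt {d : ℕ} : @KestenHairpin.hairpinAt d = @Zd.hairpinAt d := rfl

/-- **HP gives the hairpin-sparsity input on `ℤ²`** with `Q = 320`, `C = Σ_{r<20} c_r`.
[cite: MadrasSlade1993, Theorem 7.2.3 (U-turn instance, explicit; via Lemma 7.2.5)] -/
theorem hairpinSparse_Z2 : HairpinSparse 0 320 (∑ r ∈ Finset.range 20, (count 2 r : ℝ)) := by
  intro N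
  have h := Zd.hairpin_density_explicit N
  exact h

/-- **Kesten's inequality (7.3.3) on `ℤ²`, unconditional with an explicit constant**:
`c_{n+2}/c_n − B/n ≤ c_{n+4}/c_{n+2}` for all `n ≥ 1` with `B = kestenB 0 320 (Σ_{r<20} c_r)`.
[cite: MadrasSlade1993, Lemma 7.3.1, eq. (7.3.3) and Theorem 7.3.2 (a) (explicit constant, this file)] -/
theorem kestenIneqZ2_holds : KestenIneqZ2 (kestenB 0 320 (∑ r ∈ Finset.range 20, (count 2 r : ℝ))) :=
  kestenIneqZ2_of_hairpinSparse (by norm_num) hairpinSparse_Z2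

/-- **Kesten's ratio limit theorem on `ℤ²` with an explicit rate, unconditional**: for every `N ≥ 1`,
`|c_{N+2}/c_N − μ²| ≤ μ √(12 (B + 16) (G(2N) + 1)/N)` with `B = kestenB 0 320 (Σ_{r<20} c_r)` and the
Hammersley–Welsh envelope `G = KestenRate.hwEnvelope μ` (`= O(N^{-1/4})`; printed: Kesten 1963, exponent `1/3`,
constant inexplicit). [cite: MadrasSlade1993, §7.5, eq. (7.5.1) and Theorem 7.3.2 (a) (quantitative form,
unconditional on ℤ², this file)] -/
theorem ratioRate_Z2 {N : ℕ} (hN : 1 ≤ N) :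
    |(count 2 (N + 2) : ℝ) / count 2 N - connectiveConstant 2 ^ 2| ≤
      connectiveConstant 2 *
        Real.sqrt (12 * (kestenB 0 320 (∑ r ∈ Finset.range 20, (count 2 r : ℝ)) + 16) *
          (KestenRate.hwEnvelope (connectiveConstant 2) (2 * N) + 1) / N) := by
  have h := ratioRate_of_hairpinSparse (d := 0) (by norm_num) hairpinSparse_Z2 hN
  have e2 : (2 * (((0 : ℕ) : ℝ) + 2)) ^ 2 = 16 := by norm_num
  rw [e2] at h
  exact h

/-- The lane's typed `KestenRatioRateZ2` (seat a-idea-2, Sketch_v5 §25), unconditionally: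
`∃ K, ∀ N ≥ 1, |c_{N+2}/c_N − μ²| ≤ K √((G(2N)+1)/N)`. [cite: MadrasSlade1993, §7.5, eq. (7.5.1)
(quantitative form, unconditional on ℤ², this file)] -/
theorem kestenRatioRateZ2 :
    ∃ K : ℝ, ∀ N : ℕ, 1 ≤ N →
      |(count 2 (N + 2) : ℝ) / count 2 N - connectiveConstant 2 ^ 2| ≤
        K * Real.sqrt ((KestenRate.hwEnvelope (connectiveConstant 2) (2 * N) + 1) / N) :=
  kestenRatioRateZ2_of_hairpinSparse (by norm_num) hairpinSparse_Z2

end KestenHairpin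

end Literature.Probability.RandomPlanarGeometry.SAW.Zd
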